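import Literature.Geometry.Riemannian.RoundConeExit
import Literature.Geometry.Riemannian.UnwindingMap
import Literature.Geometry.Riemannian.SurgeryPolarMetric
import HarnessLib

/-!
# The round model of the interior surgery of Weinstein's disk

Topic `Geometry/Riemannian`. Assembly, in the round picture (unit ball of the model open set
`U : Opens V` with a Riemannian chart metric `g_U`, components `G_U`), of

* the coordinate cone map of the boundary sphere (`RoundConeMap.lean`, `RoundConeExit.lean`),
* its unwinding to a smooth injective immersion `F` of the ball `B(0, 1+δ)` (`UnwindingMap.lean`),
* and the polar metric `P` with tangential part interpolating `F^* g_U` and the inner product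
  (`SurgeryPolarMetric.lean`),

into the **model surgery data** of Weinstein 1968, proof of the main theorem, step (3):

* `exists_roundSurgeryModel` — under the normalisation `q(p) = G_U(p)(N p, N p) ≥ 1` on the unit
  sphere and the Christoffel bound `⟪p, Γ_p(X)(X)⟫ ≤ λ √q G_U(X, X)` there, **there are `δ > 0`,
  `F : V → V` and `P` with: `F` `C^∞`, `= id` on `B(0, 1/3)`, injective with injective differentials
  on `B(0, 1+δ)`, `F(B(0,1+δ)) ⊆ U`; `P` `C^∞`, symmetric, positive definite on the ball, `= ⟪·,·⟫` on
  `B(0, 1/2)`, radial (`P_v(v,v) = ‖v‖²`, `P_v(v, β) = 0` for `β ⊥ v`), equal to the pullback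
  `F^* G_U` on the collar `{1-δ ≤ ‖v‖ < 1+δ}`, and satisfying the exit inequality
  `-(λ P_u(w, w)) ≤ ½ d/dt|_1 P_{tu}(tw, tw)` for unit `u`.**

Pushed forward to the manifold along the tube map, `P` is the metric of the disk after surgery and
`F` its polar chart: hypotheses `hFs, hF0, hdF0, hinj, hdF, hrad, hgauss, hexit` of
`WeinsteinCriterion.two_le_minimalGeodesicMultiplicity_of_radial`.

## References

* A. Weinstein, Ann. of Math. (2) 87 (1968), 29–41, proof of the main theorem, step (3).
  [cite: Weinstein1968]

Tags: [Surgery] [PolarMetric] [Weinstein1968]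
-/

noncomputable section

open Bundle Set Function Filter TopologicalSpace Metric Module
open scoped Manifold ContDiff Topology RealInnerProductSpace

namespace Literature.Geometry.Riemannian

open Literature.Geometry.Lorentzian
open Literature.Geometry.Lorentzian.OpensChart
open Literature.Geometry.Lorentzian.PseudoRiemannianMetric

variable {V : Type*} [NormedAddCommGroup V] [InnerProductSpace ℝ V] [FiniteDimensional ℝ V]
  {U : Opens V}
  (gU : PseudoRiemannianMetric 𝓘(ℝ, V) ∞ V (TangentSpace 𝓘(ℝ, V) : U → Type _)) [gU.HasLeviCivita]
  (GU : V → V →L[ℝ] V →L[ℝ] ℝ)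

set_option maxHeartbeats 3200000 in
/-- **The round model of the surgery, with the polar chart onto the closed unit ball** (last
conjunct: `closedBall 0 1 ⊆ F(closedBall 0 1)`). See the module docstring.
[cite: Weinstein1968, proof of the main theorem, step (3)] -/
theorem exists_roundSurgeryModel_onto {d : ℕ} (hdimE : finrank ℝ V = d + 1)
    (hG : ∀ y : U, gU.val y = GU y) (hgU : gU.IsRiemannian) (u₀ : U) {εU : ℝ} (hεU : 0 < εU)
    (hUball : ball (0 : V) (1 + εU) ⊆ (U : Set V))
    (hq1 : ∀ p : U, ‖(p : V)‖ = 1 →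
      1 ≤ GU p ((GU p).inverse (innerSL ℝ (p : V))) ((GU p).inverse (innerSL ℝ (p : V))))
    {lam : ℝ} (hlam : 0 ≤ lam)
    (hΓ : ∀ p : U, ‖(p : V)‖ = 1 → ∀ X : V,
      ⟪(p : V), christoffel gU GU p X X⟫ ≤
        lam * Real.sqrt (GU p ((GU p).inverse (innerSL ℝ (p : V))) ((GU p).inverse (innerSL ℝ (p : V)))) *
          GU p X X) :
    ∃ δ : ℝ, 0 < δ ∧ ∃ (F : V → V) (P : V → V →L[ℝ] V →L[ℝ] ℝ),
      ContDiffOn ℝ ∞ F (ball (0 : V) (1 + δ)) ∧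
      (∀ v : V, ‖v‖ ≤ 1 / 3 → F v = v) ∧
      InjOn F (ball (0 : V) (1 + δ)) ∧
      (∀ v ∈ ball (0 : V) (1 + δ), Injective (fderiv ℝ F v)) ∧
      (∀ v ∈ ball (0 : V) (1 + δ), F v ∈ (U : Set V)) ∧
      ContDiffOn ℝ ∞ P (ball (0 : V) (1 + δ)) ∧
      (∀ v ∈ ball (0 : V) (1 + δ), ∀ a b : V, P v a b = P v b a) ∧
      (∀ v ∈ ball (0 : V) (1 + δ), ∀ a : V, a ≠ 0 → 0 < P v a a) ∧
      (∀ v : V, ‖v‖ ≤ 1 / 2 → P v = innerSL ℝ) ∧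
      (∀ v ∈ ball (0 : V) (1 + δ), v ≠ 0 → P v v v = ‖v‖ ^ 2) ∧
      (∀ v ∈ ball (0 : V) (1 + δ), v ≠ 0 → ∀ β : V, ⟪v, β⟫ = 0 → P v v β = 0) ∧
      (∀ v : V, 1 - δ ≤ ‖v‖ → ‖v‖ < 1 + δ → ∀ a b : V,
        P v a b = GU (F v) (fderiv ℝ F v a) (fderiv ℝ F v b)) ∧
      (∀ u w : V, ‖u‖ = 1 →
        -(lam * P u w w) ≤ (1 / 2) * deriv (fun t : ℝ ↦ P (t • u) (t • w) (t • w)) 1) ∧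
      closedBall (0 : V) 1 ⊆ F '' closedBall (0 : V) 1 := by
  haveI : CompleteSpace V := FiniteDimensional.complete ℝ V
  -- the unit sphere lies in `U`
  have hSU : ∀ w : V, ‖w‖ = 1 → w ∈ U := fun w hw ↦
    hUball (by rw [mem_ball_zero_iff, hw]; linarith)
  /- ── the coordinate cone map ── -/
  set Cf : V → V := fun v : V ↦ ((expMap gU.leviCivita ((extChartAt 𝓘(ℝ, V) u₀).symm (‖v‖⁻¹ • v))
      ((‖v‖ - 1) • ((Real.sqrt (GU (((extChartAt 𝓘(ℝ, V) u₀).symm (‖v‖⁻¹ • v) : U) : V) ((GU (((extChartAt 𝓘(ℝ, V) u₀).symm (‖v‖⁻¹ • v) : U) : V)).inverse (innerSL ℝ (((extChartAt 𝓘(ℝ, V) u₀).symm (‖v‖⁻¹ • v) : U) : V))) ((GU (((extChartAt 𝓘(ℝ, V) u₀).symm (‖v‖⁻¹ • v) : U) : V)).inverse (innerSL ℝ (((extChartAt 𝓘(ℝ, V) u₀).symm (‖v‖⁻¹ • v) : U) : V)))))⁻¹ • (GU (((extChartAt 𝓘(ℝ, V) u₀).symm (‖v‖⁻¹ • v) :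 U) : V)).inverse (innerSL ℝ (((extChartAt 𝓘(ℝ, V) u₀).symm (‖v‖⁻¹ • v) : U) : V)) : TangentSpace 𝓘(ℝ, V) ((extChartAt 𝓘(ℝ, V) u₀).symm (‖v‖⁻¹ • v)))) : U) : V) with hCfdef
  obtain ⟨εc, hεc, hεc1, hcone⟩ := exists_roundConeMap gU GU hdimE hG hgU u₀ hSU
  obtain ⟨hCs, hCid, hCder, hGauss⟩ := hcone Cf (fun v ↦ rfl)
  have hexitC := roundConeMap_exit gU GU hdimE hG hgU u₀ hSU hlam hΓ Cf (fun v ↦ rfl)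
  -- the normalisation `1 ≤ ⟪u, D Cf_u u⟫`
  have hCtr : ∀ u : V, ‖u‖ = 1 → 1 ≤ ⟪u, fderiv ℝ Cf u u⟫ := by
    intro u hu
    rw [hCder u hu, inner_smul_right]
    set p : U := ⟨u, hSU u hu⟩ with hp
    set Nr : V := (GU u).inverse (innerSL ℝ u) with hNr
    have hq : GU u Nr Nr = ⟪u, Nr⟫ := by
      have h := val_rawNormal gU GU hG p Nr
      rw [hG p] at h
      exact h
    have hq1' : 1 ≤ GU u Nr Nr := hq1 p hu
    rw [← hq]
    have hsq : 1 ≤ Real.sqrt (GU u Nr Nr) := by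
      rw [show (1 : ℝ) = Real.sqrt 1 from Real.sqrt_one.symm]
      exact Real.sqrt_le_sqrt hq1'
    have hpos : 0 < Real.sqrt (GU u Nr Nr) := by linarith
    rw [inv_mul_eq_div, le_div_iff₀ hpos, one_mul]
    calc Real.sqrt (GU u Nr Nr) = Real.sqrt (GU u Nr Nr) * 1 := (mul_one _).symm
      _ ≤ Real.sqrt (GU u Nr Nr) * Real.sqrt (GU u Nr Nr) := mul_le_mul_of_nonneg_left hsq hpos.le
      _ = GU u Nr Nr := Real.mul_self_sqrt (by linarith)
  /- ── the unwinding ── -/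
  set ε : ℝ := min εc (min εU (1 / 2)) with hεdef
  have hε : 0 < ε := lt_min hεc (lt_min hεU (by norm_num))
  have hεεc : ε ≤ εc := min_le_left _ _
  have hεεU : ε ≤ εU := (min_le_right _ _).trans (min_le_left _ _)
  have hεhalf : ε ≤ 1 / 2 := (min_le_right _ _).trans (min_le_right _ _)
  have hCs' : ContDiffOn ℝ ∞ Cf {v : V | 1 - ε < ‖v‖ ∧ ‖v‖ < 1 + ε} :=
    hCs.mono fun v hv ↦ ⟨by linarith [hv.1], by linarith [hv.2]⟩
  obtain ⟨δ₁, hδ₁, hδ₁ε, F, hFs, hFid, hFC, hFinj, hFdinj, hFbound, -, -, hFonto⟩ :=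
    exists_unwinding_extension_ball hε hCs' hCid hCtr
  have hδ₁εc : δ₁ < εc := hδ₁ε.trans_le hεεc
  have hδ₁half : δ₁ < 1 / 2 := hδ₁ε.trans_le hεhalf
  have hFU : ∀ v ∈ ball (0 : V) (1 + δ₁), F v ∈ (U : Set V) := by
    intro v hv
    apply hUball
    rw [mem_ball_zero_iff]
    exact (hFbound v hv).trans_le (by linarith)
  -- `F = Cf` near the points of the open collar, hence equal derivatives
  have hFCev : ∀ v : V, 1 - δ₁ < ‖v‖ → ‖v‖ < 1 + δ₁ → F =ᶠ[𝓝 v] Cf := by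
    intro v h1 h2
    have hopen : IsOpen {x : V | 1 - δ₁ < ‖x‖ ∧ ‖x‖ < 1 + δ₁} :=
      (isOpen_lt continuous_const continuous_norm).inter (isOpen_lt continuous_norm continuous_const)
    filter_upwards [hopen.mem_nhds (show v ∈ {x : V | 1 - δ₁ < ‖x‖ ∧ ‖x‖ < 1 + δ₁} from ⟨h1, h2⟩)]
      with x hx
    exact hFC x hx.1.le hx.2
  have hFCd : ∀ v : V, 1 - δ₁ < ‖v‖ → ‖v‖ < 1 + δ₁ → fderiv ℝ F v = fderiv ℝ Cf v :=
    fun v h1 h2 ↦ (hFCev v h1 h2).fderiv_eq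
  /- ── the pullback field `B = F^* G_U` ── -/
  set B : V → V →L[ℝ] V →L[ℝ] ℝ := fun v ↦
    ((GU (F v)).comp (fderiv ℝ F v)).flip.comp (fderiv ℝ F v) |>.flip with hBdef
  have hBapply : ∀ v a b : V, B v a b = GU (F v) (fderiv ℝ F v a) (fderiv ℝ F v b) := by
    intro v a b; rfl
  have hBs : ContDiffOn ℝ ∞ B (ball (0 : V) (1 + δ₁)) := by
    have hdF : ContDiffOn ℝ ∞ (fderiv ℝ F) (ball (0 : V) (1 + δ₁)) :=
      hFs.fderiv_of_isOpen isOpen_ball (by simp)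
    have hGF : ContDiffOn ℝ ∞ (fun v : V ↦ GU (F v)) (ball (0 : V) (1 + δ₁)) := by
      intro v hv
      have h1 : ContDiffAt ℝ ∞ GU (F v) := by
        have := contDiffAt_metricComponents gU GU hG ⟨F v, hFU v hv⟩
        exact this
      exact (h1.comp_contDiffWithinAt v (hFs v hv)).mono le_rfl |>.mono_of_mem_nhdsWithin
        (self_mem_nhdsWithin)
    rw [contDiffOn_clm_apply]
    intro a
    rw [contDiffOn_clm_apply]
    intro b
    have ha : ContDiffOn ℝ ∞ (fun v : V ↦ fderiv ℝ F v a) (ball (0 : V) (1 + δ₁)) :=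
      hdF.clm_apply contDiffOn_const
    have hb : ContDiffOn ℝ ∞ (fun v : V ↦ fderiv ℝ F v b) (ball (0 : V) (1 + δ₁)) :=
      hdF.clm_apply contDiffOn_const
    exact ((hGF.clm_apply ha).clm_apply hb).congr fun v _ ↦ hBapply v a b
  have hBsymm : ∀ v ∈ ball (0 : V) (1 + δ₁), ∀ a b : V, B v a b = B v b a := by
    intro v hv a b
    rw [hBapply, hBapply]
    have h := gU.symm ⟨F v, hFU v hv⟩ (fderiv ℝ F v a) (fderiv ℝ F v b)
    rw [hG] at h
    exact h
  have hBpos : ∀ v ∈ ball (0 : V) (1 + δ₁), ∀ a : V, a ≠ 0 → 0 < B v a a := by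
    intro v hv a ha
    rw [hBapply]
    have hne : fderiv ℝ F v a ≠ 0 := by
      intro h0
      exact ha (hFdinj v hv (by rw [h0, map_zero]))
    have h := hgU ⟨F v, hFU v hv⟩ (fderiv ℝ F v a) hne
    rw [hG] at h
    exact h
  -- radiality on the collar `1 - δ₁/2 ≤ ‖v‖ < 1 + δ₁/2`
  have hBrad : ∀ v : V, 1 - δ₁ / 2 ≤ ‖v‖ → ‖v‖ < 1 + δ₁ / 2 →
      B v v v = ‖v‖ ^ 2 ∧ ∀ β : V, ⟪v, β⟫ = 0 → B v v β = 0 := by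
    intro v h1 h2
    have h1' : 1 - δ₁ < ‖v‖ := by linarith
    have h2' : ‖v‖ < 1 + δ₁ := by linarith
    have hvc1 : 1 - εc < ‖v‖ := by linarith
    have hvc2 : ‖v‖ < 1 + εc := by linarith
    obtain ⟨hg1, hg2⟩ := hGauss v hvc1 hvc2
    have hFv : F v = Cf v := hFC v h1'.le h2'
    constructor
    · rw [hBapply, hFCd v h1' h2', hFv]; exact hg1
    · intro β hβ
      rw [hBapply, hFCd v h1' h2', hFv]; exact hg2 β hβ
  /- ── the polar metric ── -/
  set δ : ℝ := δ₁ / 2 with hδ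
  have hδpos : 0 < δ := by rw [hδ]; linarith
  have hδ4 : δ ≤ 1 / 4 := by rw [hδ]; linarith
  have hball : ball (0 : V) (1 + δ) ⊆ ball (0 : V) (1 + δ₁) :=
    ball_subset_ball (by rw [hδ]; linarith)
  obtain ⟨P, hPs, hPsymm, hPpos, hPvv, hPvβ, hPB, hPin⟩ :=
    exists_surgeryPolarMetric (B := B) hδpos hδ4 (hBs.mono hball)
      (fun v hv ↦ hBsymm v (hball hv)) (fun v hv ↦ hBpos v (hball hv))
      (fun v h1 h2 ↦ hBrad v h1 h2)
  refine ⟨δ, hδpos, F, P, hFs.mono hball, hFid, hFinj.mono hball,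
    fun v hv ↦ hFdinj v (hball hv), fun v hv ↦ hFU v (hball hv), hPs, hPsymm, hPpos, hPin, hPvv, hPvβ,
    ?_, ?_, hFonto⟩
  · -- `P = F^* G_U` on the collar
    intro v h1 h2 a b
    rw [hPB v h1 h2, hBapply]
  · -- the exit inequality, transferred from the cone map by locality at `t = 1`
    intro u w hu
    have hu1 : 1 - δ ≤ ‖u‖ := by rw [hu]; linarith
    have hu2 : ‖u‖ < 1 + δ := by rw [hu]; linarith
    have hu1' : 1 - δ₁ < ‖u‖ := by rw [hu]; linarith
    have hu2' : ‖u‖ < 1 + δ₁ := by rw [hu]; linarith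
    -- value at `t = 1`
    have hval : P u w w = GU (Cf u) (fderiv ℝ Cf u w) (fderiv ℝ Cf u w) := by
      rw [hPB u hu1 hu2, hBapply, hFCd u hu1' hu2', hFC u hu1'.le hu2']
    -- the functions of `t` agree near `1`
    have hfun : (fun t : ℝ ↦ P (t • u) (t • w) (t • w)) =ᶠ[𝓝 1]
        fun t : ℝ ↦ GU (Cf (t • u)) (fderiv ℝ Cf (t • u) (t • w)) (fderiv ℝ Cf (t • u) (t • w)) := by
      have hopen : IsOpen (Ioo (1 - δ) (1 + δ)) := isOpen_Ioo
      filter_upwards [hopen.mem_nhds (show (1 : ℝ) ∈ Ioo (1 - δ) (1 + δ) from ⟨by linarith, by linarith⟩)]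
        with t ht
      have htpos : 0 < t := by linarith [ht.1]
      have hn : ‖t • u‖ = t := by rw [norm_smul, Real.norm_eq_abs, abs_of_pos htpos, hu, mul_one]
      have ht1 : 1 - δ ≤ ‖t • u‖ := by rw [hn]; exact ht.1.le
      have ht2 : ‖t • u‖ < 1 + δ := by rw [hn]; exact ht.2
      have ht1' : 1 - δ₁ < ‖t • u‖ := by rw [hn]; linarith [ht.1]
      have ht2' : ‖t • u‖ < 1 + δ₁ := by rw [hn]; linarith [ht.2]
      rw [hPB (t • u) ht1 ht2, hBapply, hFCd (t • u) ht1' ht2', hFC (t • u) ht1'.le ht2']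
    rw [hval, hfun.deriv_eq]
    exact hexitC u w hu

set_option maxHeartbeats 400000 in
/-- **The round model of the surgery.** See the module docstring.
[cite: Weinstein1968, proof of the main theorem, step (3)] -/
theorem exists_roundSurgeryModel {d : ℕ} (hdimE : finrank ℝ V = d + 1)
    (hG : ∀ y : U, gU.val y = GU y) (hgU : gU.IsRiemannian) (u₀ : U) {εU : ℝ} (hεU : 0 < εU)
    (hUball : ball (0 : V) (1 + εU) ⊆ (U : Set V))
    (hq1 : ∀ p : U, ‖(p : V)‖ = 1 →
      1 ≤ GU p ((GU p).inverse (innerSL ℝ (p : V))) ((GU p).inverse (innerSL ℝ (p : V))))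
    {lam : ℝ} (hlam : 0 ≤ lam)
    (hΓ : ∀ p : U, ‖(p : V)‖ = 1 → ∀ X : V,
      ⟪(p : V), christoffel gU GU p X X⟫ ≤
        lam * Real.sqrt (GU p ((GU p).inverse (innerSL ℝ (p : V))) ((GU p).inverse (innerSL ℝ (p : V)))) *
          GU p X X) :
    ∃ δ : ℝ, 0 < δ ∧ ∃ (F : V → V) (P : V → V →L[ℝ] V →L[ℝ] ℝ),
      ContDiffOn ℝ ∞ F (ball (0 : V) (1 + δ)) ∧
      (∀ v : V, ‖v‖ ≤ 1 / 3 → F v = v) ∧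
      InjOn F (ball (0 : V) (1 + δ)) ∧
      (∀ v ∈ ball (0 : V) (1 + δ), Injective (fderiv ℝ F v)) ∧
      (∀ v ∈ ball (0 : V) (1 + δ), F v ∈ (U : Set V)) ∧
      ContDiffOn ℝ ∞ P (ball (0 : V) (1 + δ)) ∧
      (∀ v ∈ ball (0 : V) (1 + δ), ∀ a b : V, P v a b = P v b a) ∧
      (∀ v ∈ ball (0 : V) (1 + δ), ∀ a : V, a ≠ 0 → 0 < P v a a) ∧
      (∀ v : V, ‖v‖ ≤ 1 / 2 → P v = innerSL ℝ) ∧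
      (∀ v ∈ ball (0 : V) (1 + δ), v ≠ 0 → P v v v = ‖v‖ ^ 2) ∧
      (∀ v ∈ ball (0 : V) (1 + δ), v ≠ 0 → ∀ β : V, ⟪v, β⟫ = 0 → P v v β = 0) ∧
      (∀ v : V, 1 - δ ≤ ‖v‖ → ‖v‖ < 1 + δ → ∀ a b : V,
        P v a b = GU (F v) (fderiv ℝ F v a) (fderiv ℝ F v b)) ∧
      (∀ u w : V, ‖u‖ = 1 →
        -(lam * P u w w) ≤ (1 / 2) * deriv (fun t : ℝ ↦ P (t • u) (t • w) (t • w)) 1) := by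
  obtain ⟨δ, hδ, F, P, h1, h2, h3, h4, h5, h6, h7, h8, h9, h10, h11, h12, h13, -⟩ :=
    exists_roundSurgeryModel_onto gU GU hdimE hG hgU u₀ hεU hUball hq1 hlam hΓ
  exact ⟨δ, hδ, F, P, h1, h2, h3, h4, h5, h6, h7, h8, h9, h10, h11, h12, h13⟩

end Literature.Geometry.Riemannian

end
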